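import Summits.CriticalPhenomena.CardyFormulaZ2.Theorems.CardyComplexConeEdgePrecompactUFRSEvents
import Summits.CriticalPhenomena.CardyFormulaZ2.Theorems.CardyComplexConeEdgePrecompactShiftStabilityReduction

/-!
# UFRS, decay at the marked points (rectangles), part 1: monotonicity of the strand-crossing events
(line `qkz-strip-boundary-arm` of crux `CardyComplexCone.EdgePrecompact`, stmt-CriticalPhenomena-11387;
support for the registered sub-goal `ufrs_markedPointDecay_rect`, wave 3 of lead c4)

Elementary facts about the events of `…EdgePrecompactUFRSEvents.lean` used by the probabilistic
decay of the MARKED and NEAR branches of the UFRS certificate: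

* `ufrsStrands_mono_W3M` — **re-centring / shrinking**: a family of `k` strand-crossings of
  `A(z; r, R)` is a family of `k` strand-crossings of `A(z'; r', R')` whenever `dist z z' ≤ t`,
  `r + t ≤ r'`, `R' + t ≤ R` (triangle inequality on the two endpoint conditions; the witnesses are
  unchanged);
* `ufrsStrands_two_of_three_W3M` — three strand-crossings contain two;
* `finite_markedEdges_W3M`, `card_markedEdges_le_W3M` — the marked edges of `E` and of its translate
  `shiftData E w` form a finite set of at most four edges (`ncard_zdABEdges_eq_two` for both data,
  `isZdAdmissible_shiftData`);
* `ufrsCertNear_subset_W3M` — the NEAR branch at any collar point lies in the union over the (at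
  most four) marked edges `e₀` of "two strand-crossings of `A(m(e₀); 768 η, ρ/4 - 256 η)`".

References: S. Smirnov, C. R. Acad. Sci. Paris 333 (2001), §2; G. F. Lawler, O. Schramm, W. Werner,
Electron. J. Probab. 7 (2002), Appendix A (boundary arm events).
-/

namespace Summit.CriticalPhenomena.CardyFormulaZ2.Cruxes.EdgePrecompact.QkzStripBoundaryArm

open MeasureTheory Filter Set Metric
open scoped Topology BigOperators Pointwise
open Literature.Probability.LatticeModels Literature.Probability.Percolation
open Literature.Probability.RandomPlanarGeometry (DobrushinDomain)
open Summit.CriticalPhenomena.CardyFormulaZ2.Theses.CardyComplexCone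

noncomputable section

/-! ## Monotonicity of `ufrsStrands` in centre and radii -/

/-- **Re-centring and shrinking the annulus.** If `dist z z' ≤ t`, `r + t ≤ r'` and `R' + t ≤ R`,
then `k` strand-crossings of `A(z; r, R)` are `k` strand-crossings of `A(z'; r', R')` (same
witnesses; the endpoint within `r` of `z` is within `r'` of `z'`, the endpoint at distance `≥ R`
from `z` is at distance `≥ R'` from `z'`). -/
theorem ufrsStrands_mono_W3M : ∀ (E : DiscreteDobrushin) (w : Site 2) {z z' : ℂ} (k : ℕ) {r R r' R' t : ℝ}, dist z z' ≤ t → r + t ≤ r' → R' + t ≤ R → ufrsStrands E w z k r R ⊆ ufrsStrands E w z' k r' R' := by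
  intro E w z z' k r R r' R' t hzz' hr hR ω hω
  rw [mem_ufrsStrands_iff] at hω ⊢
  obtain ⟨c, i, j, τ, h, hdis⟩ := hω
  refine ⟨c, i, j, τ, fun a => ⟨(h a).1, ?_, (h a).2.2⟩, hdis⟩
  have key : ∀ p : ℂ, (dist p z ≤ r → dist p z' ≤ r') ∧ (R ≤ dist p z → R' ≤ dist p z') := by
    intro p
    have h1 := dist_triangle p z z'
    have h2 := dist_triangle p z' z
    rw [dist_comm z' z] at h2
    constructor
    · intro hp; linarith
    · intro hp; linarith
  rcases (h a).2.1 with ⟨h1, h2⟩ | ⟨h1, h2⟩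
  · exact Or.inl ⟨(key _).1 h1, (key _).2 h2⟩
  · exact Or.inr ⟨(key _).2 h1, (key _).1 h2⟩

/-- **Three strand-crossings contain two** (keep the first two witnesses). -/
theorem ufrsStrands_two_of_three_W3M (E : DiscreteDobrushin) (w : Site 2) (z : ℂ) (r R : ℝ) :
    ufrsStrands E w z 3 r R ⊆ ufrsStrands E w z 2 r R := by
  intro ω hω
  rw [mem_ufrsStrands_iff] at hω ⊢
  obtain ⟨c, i, j, τ, h, hdis⟩ := hω
  refine ⟨fun a => c (Fin.castLE (by norm_num) a), fun a => i (Fin.castLE (by norm_num) a),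
    fun a => j (Fin.castLE (by norm_num) a), fun a => τ (Fin.castLE (by norm_num) a),
    fun a => h _, fun a b hab => hdis _ _ ?_⟩
  intro heq
  exact hab (Fin.castLE_injective _ heq)

/-! ## The marked edges of the two data -/

/-- The marked (`A`–`B`) edges of `E` and of `shiftData E w` form a finite set (two each). -/
theorem finite_markedEdges_W3M {E : DiscreteDobrushin} (hE : E.IsZdAdmissible) (w : Site 2) :
    (E.zdABEdges ∪ (shiftData E w).zdABEdges).Finite := by
  refine Set.Finite.union ?_ ?_
  · exact Set.finite_of_ncard_ne_zero (by rw [hE.ncard_zdABEdges_eq_two]; norm_num)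
  · exact Set.finite_of_ncard_ne_zero
      (by rw [(isZdAdmissible_shiftData E w hE).ncard_zdABEdges_eq_two]; norm_num)

/-- There are at most four marked edges of `E` and `shiftData E w` together. -/
theorem card_markedEdges_le_W3M {E : DiscreteDobrushin} (hE : E.IsZdAdmissible) (w : Site 2) :
    (finite_markedEdges_W3M hE w).toFinset.card ≤ 4 := by
  rw [← Set.ncard_eq_toFinset_card _ (finite_markedEdges_W3M hE w)]
  calc (E.zdABEdges ∪ (shiftData E w).zdABEdges).ncard
      ≤ E.zdABEdges.ncard + (shiftData E w).zdABEdges.ncard := Set.ncard_union_le _ _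
    _ = 4 := by
        rw [hE.ncard_zdABEdges_eq_two, (isZdAdmissible_shiftData E w hE).ncard_zdABEdges_eq_two]

/-- Membership in the finite set of marked edges, unfolded. -/
theorem mem_markedEdges_toFinset_W3M {E : DiscreteDobrushin} (hE : E.IsZdAdmissible) (w : Site 2)
    (e₀ : Sym2 (Site 2)) :
    e₀ ∈ (finite_markedEdges_W3M hE w).toFinset ↔ (e₀ ∈ E.zdABEdges ∨ e₀ ∈ (shiftData E w).zdABEdges) := by
  rw [Set.Finite.mem_toFinset, Set.mem_union]

/-! ## The NEAR branch is a two-strand crossing around a marked edge -/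

/-- **The NEAR branch re-centred at its marked edge.** At every point `z`, the NEAR branch of the
certificate with inner radius `4η` and outer radius `ρ/2` (a marked edge `e₀` within `256 η` of
`z` and two strand-crossings of `A(z; 512 η, ρ/4)`) gives two strand-crossings of
`A(m; 768 η, ρ/4 - 256 η)` around the midpoint `m` of `e₀`. -/
theorem ufrsCertNear_subset_W3M {E : DiscreteDobrushin} (hE : E.IsZdAdmissible) (w : Site 2) (η ρ : ℝ) (z : ℂ) :
    ufrsCertNear E w z (4 * η) (ρ / 2) ⊆
      ⋃ e₀ ∈ (finite_markedEdges_W3M hE w).toFinset,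
        ufrsStrands E w (medialPoint E.δ e₀) 2 (768 * η) (ρ / 4 - 256 * η) := by
  intro ω hω
  rw [mem_ufrsCertNear_iff, mem_ufrsMarkedNbhd_iff] at hω
  obtain ⟨⟨e₀, he₀, hdist⟩, hstr⟩ := hω
  rw [Set.mem_iUnion₂]
  refine ⟨e₀, (mem_markedEdges_toFinset_W3M hE w e₀).2 he₀, ?_⟩
  refine ufrsStrands_mono_W3M E w 2 (t := 256 * η) ?_ ?_ ?_ hstr
  · rw [dist_comm]; linarith
  · linarith
  · linarith

/-- **The NEAR event over the collar is a finite union of two-strand crossings at the marked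
edges**: for every configuration in `{ω | ∃ z ∈ D, infDist z Dᶜ < 3η ∧ ω ∈ ufrsCertNear …}` some
marked edge carries two strand-crossings of `A(m; 768 η, ρ/4 - 256 η)`. -/
theorem setOf_ufrsCertNear_subset_W3M {E : DiscreteDobrushin} (hE : E.IsZdAdmissible) (w : Site 2) (η ρ : ℝ)
    (Ω : Set ℂ) :
    {ω : BondConfig (Site 2) | ∃ z ∈ Ω, infDist z Ωᶜ < 3 * η ∧ ω ∈ ufrsCertNear E w z (4 * η) (ρ / 2)} ⊆
      ⋃ e₀ ∈ (finite_markedEdges_W3M hE w).toFinset,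
        ufrsStrands E w (medialPoint E.δ e₀) 2 (768 * η) (ρ / 4 - 256 * η) := by
  rintro ω ⟨z, -, -, hω⟩
  exact ufrsCertNear_subset_W3M hE w η ρ z hω

end

end Summit.CriticalPhenomena.CardyFormulaZ2.Cruxes.EdgePrecompact.QkzStripBoundaryArm
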